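import Mathlib
import Literature.Probability.RandomPlanarGeometry.HexSAW
import Summits.CriticalPhenomena.SAWScalingLimit.Theses.SAWMassiveIsingTilt
import Summits.CriticalPhenomena.SAWScalingLimit.Theorems.SAWMassiveIsingTiltCornerLaw
import HarnessLib

/-!
# Objects of route `SAWMassiveIsingTilt` — the tilted interface family, as named definitions

Route `CriticalPhenomena/SAWScalingLimit/SAWMassiveIsingTilt`; written by the lead prover of the
crux `CriticalCurveContinuity` (stmt-CriticalPhenomena-7686, line `registered` =
`Cruxes/CriticalCurveContinuity/Lines/birth.lean`) so that the line's stub files and the other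
items of the route (`MassiveWindowSLE`, `RestrictionFromMass`) can speak about the route's objects
BY NAME instead of re-inlining the route file's shared `let`s.

This file only DEFINES objects and two predicates; it asserts no statement of the route or of the
line (the stub statements stay in the skeleton / stub files):

* `Zloop H S y` — the loop-`O(1)` (high-temperature Ising) partition function of the subgraph of
  `H` spanned by the vertex set `S` at edge weight `y`: `∑ᶠ` over finite edge sets `E ⊆ E(H)` with
  all endpoints in `S` and every vertex of even `E`-degree, of `y ^ |E|` — VERBATIM the route
  file's `let Zloop`;
* `tilt Ω δ x y a b` — the tilted weight `γ ↦ x ^ ℓ(γ) · Zloop(Ω_δ ∖ γ; y)` on hexagonal SAWs of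
  `Ω_δ` from `a` to `b` (a sum of weighted Dirac masses) — VERBATIM the route's `let tilt`;
* `tiltLaw Ω δ x y a b` — its normalisation, the tilted interface LAW `𝔓_{x,y}` — VERBATIM the
  route's `let tiltLaw` (so `OneClassOnCriticalCurve`, `MassiveWindowSLE`, `CornerLaw` unfold to
  statements about `tiltLaw` by `unfold …; dsimp only`, definitionally);
* `TiltSLE x y` — "at `(x, y)` the tilted interface converges in law to chordal SLE_{8/3} in every
  Dobrushin domain along every hexagonal endpoint approximation" (the summand of
  `OneClassOnCriticalCurve` at one parameter point);
* `SameLimit x y x' y'` — "the parameter points `(x, y)` and `(x', y')` have asymptotically equal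
  interface laws": for every Dobrushin domain, hexagonal endpoint approximation and bounded
  continuous functional of the curve class the expectations differ by `o(1)` as `δ → 0⁺` (no
  limit is assumed to exist).

Lemmas (only the corner `y = 0` and definitional unfolding): `zloop_zero` (`Zloop H S 0 = 1`, only
`E = ∅` survives), `tilt_zero` / `tiltLaw_zero` (at `y = 0` the tilted weight / law is the plain SAW
weight / law `embWeight` / `embLaw` at fugacity `x` — the route's requested `tiltedInterfaceLaw_zero`),
`tiltLaw_hexCriticalFugacity_zero` (`= hexSAWLaw`, i.e. `CornerLaw` pointwise), and the `Iff.rfl`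
readings `oneClassOnCriticalCurve_iff`, `massiveWindowSLE_iff`, `cornerLaw_iff`,
`criticalCurveContinuity_iff`, `restrictionFromMass_iff` of the route items through the named objects.

Sources for the objects: H. Duminil-Copin, S. Smirnov, Ann. of Math. 175 (2012) §4 (the law
`P_{x,δ}`; here `y = 0`) [DuminilCopinSmirnov2012]; B. Nienhuis, Phys. Rev. Lett. 49 (1982) (the
honeycomb loop gas, `y_c = 1/√3`) [Nienhuis1982]. Deliberately NOT here: any statement of the line.
-/

noncomputable section

open MeasureTheory Filter Topology Set
open scoped NNReal ENNReal BoundedContinuousFunction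
open Literature.Probability Literature.Probability.LatticeModels
  Literature.Probability.RandomPlanarGeometry

namespace Summit.CriticalPhenomena.SAWScalingLimit.Theorems.SAWMassiveIsingTilt

/-! ### The objects (the route file's shared `let`s, verbatim) -/

/-- `Zloop(H, S; y)`: the loop-`O(1)` (high-temperature Ising) partition function of the subgraph of
`H` spanned by the vertex set `S`, edge weight `y` — the sum over finite edge sets of `H` inside `S`
with all degrees even of `y ^ |E|`. Verbatim the route file's `let Zloop`. -/
def Zloop (H : SimpleGraph HexVertex) (S : Set HexVertex) (y : ℝ) : ℝ :=
  ∑ᶠ E ∈ {E : Finset (Sym2 HexVertex) |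
      (∀ e ∈ E, e ∈ H.edgeSet ∧ ∀ v ∈ e, v ∈ S) ∧
        ∀ v : HexVertex, Even (E.filter (fun e => v ∈ e)).card},
    y ^ E.card

/-- The tilted weight `γ ↦ x ^ ℓ(γ) · Zloop(Ω_δ ∖ γ; y)` on hexagonal SAWs of `Ω_δ` from `a` to `b`
(a sum of weighted Dirac masses; `ENNReal.ofReal` truncates junk negative weights to `0`).
Verbatim the route file's `let tilt`. -/
def tilt (Ω : Set ℂ) (δ : ℝ) (x y : ℝ) (a b : HexVertex) : Measure (SAW.HexDomainSAW Ω δ a b) :=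
  Measure.sum (fun γ : SAW.HexDomainSAW Ω δ a b =>
    ENNReal.ofReal (x ^ γ.vertexCount * Zloop (SAW.hexDomainGraph Ω δ) {v | v ∉ γ.walk.support} y) •
      Measure.dirac γ)

/-- The tilted interface LAW `𝔓_{x,y}` on hexagonal SAWs of `Ω_δ` from `a` to `b` (normalised
`tilt`; junk `0` when the total weight is `0` or `∞`). Verbatim the route file's `let tiltLaw`. -/
def tiltLaw (Ω : Set ℂ) (δ : ℝ) (x y : ℝ) (a b : HexVertex) : Measure (SAW.HexDomainSAW Ω δ a b) :=
  (tilt Ω δ x y a b Set.univ)⁻¹ • tilt Ω δ x y a b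

/-! ### Two predicates on parameter points -/

/-- `TiltSLE x y`: at fugacity `x` and bath temperature `y` the tilted interface law converges in
law to chordal SLE_{8/3} in every Dobrushin domain along every hexagonal endpoint approximation
(the summand of the route target `OneClassOnCriticalCurve` at one parameter point). [folklore] -/
@[folklore] def TiltSLE (x y : ℝ) : Prop :=
  ∀ (D : DobrushinDomain) (a b : ℝ → HexVertex), SAW.IsEmbEndpointApprox hexGraph hexCenter D a b →
    ConvergesInLawToSLE ((8 : ℝ≥0) / 3) D
      (fun δ (γ : SAW.HexDomainSAW D.carrier δ (a δ) (b δ)) => γ.curve)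
      (fun δ => tiltLaw D.carrier δ x y (a δ) (b δ))

/-- `SameLimit x y x' y'`: the parameter points `(x, y)` and `(x', y')` have ASYMPTOTICALLY EQUAL
interface laws — for every Dobrushin domain, hexagonal endpoint approximation and bounded continuous
functional of the curve class, the two expectations differ by `o(1)` as `δ → 0⁺` (no limit is
assumed to exist; portmanteau form as in `TendstoLaw`). [folklore] -/
@[folklore] def SameLimit (x y x' y' : ℝ) : Prop :=
  ∀ (D : DobrushinDomain) (a b : ℝ → HexVertex), SAW.IsEmbEndpointApprox hexGraph hexCenter D a b →
    ∀ f : CurveClass ℂ →ᵇ ℝ,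
      Tendsto (fun δ => (∫ γ, f γ.curve ∂(tiltLaw D.carrier δ x y (a δ) (b δ))) -
          ∫ γ, f γ.curve ∂(tiltLaw D.carrier δ x' y' (a δ) (b δ))) (𝓝[>] (0 : ℝ)) (𝓝 0)

/-! ### The corner `y = 0`: the bath switches off -/

/-- `Zloop(H, S; 0) = 1`: at loop weight `0` only the empty even subgraph survives. -/
theorem zloop_zero : ∀ (H : SimpleGraph HexVertex) (S : Set HexVertex), Zloop H S 0 = 1 := by
  intro H S
  unfold Zloop
  exact Theorems.finsum_mem_zero_pow_card_eq_one _ (by simp)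

/-- At `y = 0` the tilted weight is the plain SAW weight `γ ↦ x ^ ℓ(γ)` (`embWeight` at fugacity `x`). -/
theorem tilt_zero : ∀ (Ω : Set ℂ) (δ x : ℝ) (a b : HexVertex),
    tilt Ω δ x 0 a b = SAW.embWeight hexGraph hexCenter Ω δ x a b := by
  intro Ω δ x a b
  unfold tilt
  simp only [zloop_zero, mul_one]
  rfl

/-- At `y = 0` the tilted interface law is the SAW law `P_{x,δ}` (`embLaw` at fugacity `x`) — the
route's requested `tiltedInterfaceLaw_zero`. -/
theorem tiltLaw_zero : ∀ (Ω : Set ℂ) (δ x : ℝ) (a b : HexVertex),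
    tiltLaw Ω δ x 0 a b = SAW.embLaw hexGraph hexCenter Ω δ x a b := by
  intro Ω δ x a b
  unfold tiltLaw
  rw [tilt_zero]
  rfl

/-- At the SAW corner `(x, y) = (x_c(Hex), 0)` the tilted interface law is the critical hexagonal SAW
law `hexSAWLaw` (the item `CornerLaw`, pointwise). -/
theorem tiltLaw_hexCriticalFugacity_zero : ∀ (Ω : Set ℂ) (δ : ℝ) (a b : HexVertex),
    tiltLaw Ω δ SAW.hexCriticalFugacity 0 a b = SAW.hexSAWLaw Ω δ a b := by
  intro Ω δ a b
  exact tiltLaw_zero Ω δ SAW.hexCriticalFugacity a b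

/-! ### Definitional unfolding of the route items through the named objects -/

/-- The route target `OneClassOnCriticalCurve` read through the named objects: a critical curve
`xc` through the SAW corner with `TiltSLE (xc y) y` for every `y ∈ [0, 1/√3)` (definitional). -/
theorem oneClassOnCriticalCurve_iff :
    Summit.CriticalPhenomena.SAWScalingLimit.Theses.SAWMassiveIsingTilt.OneClassOnCriticalCurve ↔
      ∃ xc : ℝ → ℝ, xc 0 = SAW.hexCriticalFugacity ∧
        ∀ y ∈ Set.Ico (0 : ℝ) (Real.sqrt 3)⁻¹, TiltSLE (xc y) y :=
  Iff.rfl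

/-- The route crux `MassiveWindowSLE` read through the named objects: a cooling rate `m` and a tilt
`x` such that the window laws `tiltLaw … (x δ) (1/√3 - m δ · δ) …` converge in law to chordal
SLE_{8/3} (definitional). -/
theorem massiveWindowSLE_iff :
    Summit.CriticalPhenomena.SAWScalingLimit.Theses.SAWMassiveIsingTilt.MassiveWindowSLE ↔
      ∃ m x : ℝ → ℝ, Tendsto m (𝓝[>] (0 : ℝ)) atTop ∧
        Tendsto (fun δ => m δ * δ) (𝓝[>] (0 : ℝ)) (𝓝 0) ∧
        ∀ (D : DobrushinDomain) (a b : ℝ → HexVertex),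
          SAW.IsEmbEndpointApprox hexGraph hexCenter D a b →
            ConvergesInLawToSLE ((8 : ℝ≥0) / 3) D
              (fun δ (γ : SAW.HexDomainSAW D.carrier δ (a δ) (b δ)) => γ.curve)
              (fun δ => tiltLaw D.carrier δ (x δ) ((Real.sqrt 3)⁻¹ - m δ * δ) (a δ) (b δ)) :=
  Iff.rfl

/-- The route support `CornerLaw` read through the named objects: `tiltLaw Ω δ x_c 0 a b` is the
critical hexagonal SAW law (definitional unfolding of the item; its PROOF is
`Theorems.cornerLaw_proof`). -/
theorem cornerLaw_iff :
    Summit.CriticalPhenomena.SAWScalingLimit.Theses.SAWMassiveIsingTilt.CornerLaw ↔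
      ∀ (Ω : Set ℂ) (δ : ℝ) (a b : HexVertex),
        tiltLaw Ω δ SAW.hexCriticalFugacity 0 a b = SAW.hexSAWLaw Ω δ a b :=
  Iff.rfl

/-- The crux `CriticalCurveContinuity` read through the named objects (definitional). -/
theorem criticalCurveContinuity_iff :
    Summit.CriticalPhenomena.SAWScalingLimit.Theses.SAWMassiveIsingTilt.CriticalCurveContinuity ↔
      (Summit.CriticalPhenomena.SAWScalingLimit.Theses.SAWMassiveIsingTilt.MassiveWindowSLE →
        ∃ xc : ℝ → ℝ, xc 0 = SAW.hexCriticalFugacity ∧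
          ∀ y ∈ Set.Ico (0 : ℝ) (Real.sqrt 3)⁻¹, TiltSLE (xc y) y) :=
  Iff.rfl

/-- The route crux `RestrictionFromMass` (the engine, stmt-CriticalPhenomena-7687) read through the
named partition function `Zloop` (definitional). -/
theorem restrictionFromMass_iff :
    Summit.CriticalPhenomena.SAWScalingLimit.Theses.SAWMassiveIsingTilt.RestrictionFromMass ↔
      ∀ y ∈ Set.Ico (0 : ℝ) (Real.sqrt 3)⁻¹, ∃ C c : ℝ, 0 < c ∧
        ∀ (D : DobrushinDomain) (δ : ℝ), 0 < δ →
          ∀ (S : Set HexVertex) (a b : HexVertex) (γ : SAW.HexDomainSAW D.carrier δ a b),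
            (∀ v ∈ γ.walk.support, v ∈ S) →
              S ⊆ SAW.embMeshDomain hexGraph hexCenter D.carrier δ →
                let H := SAW.hexDomainGraph D.carrier δ
                let V := SAW.embMeshDomain hexGraph hexCenter D.carrier δ
                let T : Set HexVertex := {v | v ∈ γ.walk.support}
                |Real.log ((Zloop H (V \ T) y * Zloop H S y) / (Zloop H (S \ T) y * Zloop H V y))| ≤
                  C * ∑ v ∈ γ.walk.support.toFinset,
                    ∑ᶠ w ∈ V \ S, Real.exp (-(c * (hexGraph.dist v w : ℝ))) :=
  Iff.rfl

end Summit.CriticalPhenomena.SAWScalingLimit.Theorems.SAWMassiveIsingTilt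

end
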